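import Literature.Geometry.Riemannian.RicciFlow
import Literature.Geometry.Riemannian.CurvatureNormSq
import Literature.Geometry.Riemannian.ChangGurskyYangProofs
import Literature.Geometry.Riemannian.ChangGurskyYangRegularity
import Literature.Geometry.Riemannian.RicciFlowScalarCurvature
import Mathlib.Analysis.SpecialFunctions.Pow.Continuity
import Mathlib.Analysis.SpecialFunctions.Pow.Asymptotics
import HarnessLib

/-!
# Route EntropyRung · crux `ChangGurskyYang` · line `margerin-cone-hamilton-rails` — STUB 4d
# `stub_limitRound`: scale-breaking pinching makes the blow-up limit pointwise round

STUB 4d of the lead's reshape r5 of the skeleton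
`Cruxes/ChangGurskyYang/Lines/margerin_cone_hamilton_rails.lean` (crux stmt-SmoothPoincare4-10834,
`Summit.SmoothPoincare4.SmoothPoincare4.Theses.EntropyRung.ChangGurskyYang`). STUB 4 (a `β`-pinched
Ricci flow on a closed connected 4-manifold yields a metric of constant positive curvature; Hamilton
1986 §5.2 / Margerin 1998 Part VI) is proved in the skeleton along the blow-up / round-limit endgame;
this file is its bookkeeping-of-limits step (Hamilton 1986, §5, p. 163: "the curvature operator must
pinch toward a multiple of the identity as the scalar curvature blows up"; Huisken 1985, Thm. 1.1;
Margerin 1998, Lemma 27: `WP → 0`).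

Along a Ricci flow `(g, cov)` on `[0, T)` with the invariant pinching `m ≤ R` and
`|W|² + 2|E|² ≤ K R^{2−τ}` (`0 < τ ≤ 1`) at all points and times, and for scales `Qₙ → ∞`, times
`tₙ ∈ [0, T)` and ANY data `(N, h, p_∞, φₙ)` towards which the rescaled curvature invariants of
`g(tₙ)` converge pointwise along `φₙ` (`Qₙ⁻¹R → R_h`, `Qₙ⁻²|Rm|² → |Rm_h|²`, `Qₙ⁻²|W|² → |W_h|²`,
`Qₙ⁻²|E|² → |E_h|²`, normalised by `|Rm_h|²(p_∞) = 1` — the output of the named fact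
`ricciFlow_blowupLimit_four`), the limit data satisfy: all orthonormal-frame Weyl components of `h`
vanish, `Ric_h = (R_h/4) h`, and `R_h(p_∞) > 0`. Proof: after rescaling the pinching reads
`Qₙ⁻²(|W|² + 2|E|²) ≤ K · Qₙ^{−τ} · (Qₙ⁻¹R)^{2−τ}` (`rescale_rpow_eq`); the right side tends to
`K · 0 · R_h^{2−τ} = 0` (`tendsto_rpow_neg_atTop`, `Tendsto.rpow_const`), so
`|W_h|² + 2|E_h|² ≤ 0`, and both are nonnegative (`le_zero_of_tendsto_rescaled`); a zero sum of
squares kills every frame component (`weylNormSq_eq_weylNormSqFrame_four`,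
`tracelessRicciNormSq_eq_tracelessRicciNormSqFrame_four`), the traceless Ricci components vanishing
on an orthonormal basis give `Ric = (R/4) h` by bilinearity (`LinearMap.BilinForm.ext_basis`); finally
`R_h(p_∞) ≥ 0` as a limit of `Qₙ⁻¹R > 0` and `1 = |Rm_h|² = |W_h|² + 2|E_h|² + R_h²/6`
(`weylNormSq_eq_curvNormSqWith`, `tracelessRicciNormSq_eq_normSq`) force `R_h(p_∞)² = 6`.

No definitions, no named facts; everything proved.

References: R. S. Hamilton, J. Differential Geom. 24 (1986) 153–179, §5 [Hamilton1986]; G. Huisken,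
J. Differential Geom. 21 (1985) 47–62, Thm. 1.1 [Huisken1985]; C. Margerin, Comm. Anal. Geom. 6 (1998)
21–65, Part VI, Lemma 27 [Margerin1998]; A. L. Besse, Einstein Manifolds (1987), 1.116–1.118
[Besse1987].
-/

noncomputable section

-- every `Summit.SmoothPoincare4.SmoothPoincare4.…` name repeats the summit = sub-problem segment (D-0017 layout)
set_option linter.dupNamespace false

open Set Function Module Filter
open scoped Manifold ContDiff Topology

namespace Summit.SmoothPoincare4.SmoothPoincare4.Theorems.MargerinRails

open Literature.Geometry.Riemannian
open Literature.Geometry.Lorentzian Literature.Geometry.Lorentzian.PseudoRiemannianMetric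

/-! ## Two elementary lemmas on the rescaling -/

/-- **Rescaling the scale-breaking pinching**: for `Q > 0`, `R ≥ 0`,
`Q⁻² · R^{2−τ} = Q^{−τ} · (Q⁻¹R)^{2−τ}` (`Real.rpow` algebra; this is how `|M̊|² ≤ K R^{2−τ}` becomes
`|M̊|² ≤ K Q^{−τ} R^{2−τ}` for the metric `Q g`, Hamilton 1986, §5, p. 163). [folklore] -/
theorem rescale_rpow_eq {Q R : ℝ} (τ : ℝ) (hQ : 0 < Q) (hR : 0 ≤ R) :
    Q⁻¹ ^ 2 * R ^ (2 - τ) = Q ^ (-τ) * (Q⁻¹ * R) ^ (2 - τ) := by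
  rw [Real.mul_rpow (inv_nonneg.mpr hQ.le) hR, Real.inv_rpow hQ.le, ← mul_assoc]
  congr 1
  rw [← Real.rpow_neg hQ.le, ← Real.rpow_add hQ, show -τ + -(2 - τ) = -((2 : ℕ) : ℝ) by
    push_cast; ring, Real.rpow_neg hQ.le, Real.rpow_natCast, inv_pow]

/-- **The limit of a rescaled pinched quantity is nonpositive**: if `aₙ → A`, `rₙ → ρ`, `Qₙ → ∞`,
`0 < τ ≤ 2` and `aₙ ≤ K · Qₙ^{−τ} · rₙ^{2−τ}` for all `n`, then `A ≤ 0` (the right side tends to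
`K · 0 · ρ^{2−τ} = 0`). [folklore] -/
theorem le_zero_of_tendsto_rescaled {a r Q : ℕ → ℝ} {A ρ K τ : ℝ} (hτ : 0 < τ) (hτ2 : τ ≤ 2)
    (ha : Tendsto a atTop (𝓝 A)) (hr : Tendsto r atTop (𝓝 ρ)) (hQ : Tendsto Q atTop atTop)
    (hle : ∀ n, a n ≤ K * Q n ^ (-τ) * r n ^ (2 - τ)) : A ≤ 0 := by
  have h1 : Tendsto (fun n ↦ Q n ^ (-τ)) atTop (𝓝 0) := (tendsto_rpow_neg_atTop hτ).comp hQ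
  have h2 : Tendsto (fun n ↦ r n ^ (2 - τ)) atTop (𝓝 (ρ ^ (2 - τ))) :=
    hr.rpow_const (Or.inr (by linarith))
  have h3 : Tendsto (fun n ↦ K * Q n ^ (-τ) * r n ^ (2 - τ)) atTop (𝓝 (K * 0 * ρ ^ (2 - τ))) :=
    (tendsto_const_nhds.mul h1).mul h2
  rw [mul_zero, zero_mul] at h3
  exact le_of_tendsto_of_tendsto' ha h3 hle

/-! ## Frame algebra at a point of the limit -/

section Pointwise

variable {N : Type} [TopologicalSpace N] [ChartedSpace (EuclideanSpace ℝ (Fin 4)) N]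
  [IsManifold (𝓡 4) ∞ N]
  (h : PseudoRiemannianMetric (𝓡 4) ∞ (EuclideanSpace ℝ (Fin 4)) (TangentSpace (𝓡 4) : N → Type _))
  [h.HasLeviCivita]

/-- The model `ℝ⁴` has dimension `4`. [folklore] -/
theorem finrank_euclideanFour : finrank ℝ (EuclideanSpace ℝ (Fin 4)) = 4 :=
  finrank_euclideanSpace_fin

/-- **`|W|²(y) = 0` kills every Weyl component in every orthonormal frame** (a zero sum of squares,
`weylNormSq_eq_weylNormSqFrame_four`). [cite: Besse1987, 1.117] -/
theorem weylFrame_eq_zero_of_weylNormSq_eq_zero {y : N} (hW : h.weylNormSq y = 0)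
    {e : Fin 4 → TangentSpace (𝓡 4) y} (he : h.IsOrthonormalFrame y e) (i j k l : Fin 4) :
    h.weylFrame y e i j k l = 0 := by
  have h0 : h.weylNormSqFrame y e = 0 := by
    rw [← h.weylNormSq_eq_weylNormSqFrame_four finrank_euclideanFour he]; exact hW
  have hle : h.weylFrame y e i j k l ^ 2 ≤ h.weylNormSqFrame y e := by
    unfold weylNormSqFrame
    refine le_trans ?_ (Finset.single_le_sum (f := fun i ↦ ∑ j, ∑ k, ∑ l, h.weylFrame y e i j k l ^ 2)
      (fun _ _ ↦ Finset.sum_nonneg fun _ _ ↦ Finset.sum_nonneg fun _ _ ↦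
        Finset.sum_nonneg fun _ _ ↦ sq_nonneg _) (Finset.mem_univ i))
    refine le_trans ?_ (Finset.single_le_sum (f := fun j ↦ ∑ k, ∑ l, h.weylFrame y e i j k l ^ 2)
      (fun _ _ ↦ Finset.sum_nonneg fun _ _ ↦ Finset.sum_nonneg fun _ _ ↦ sq_nonneg _)
      (Finset.mem_univ j))
    refine le_trans ?_ (Finset.single_le_sum (f := fun k ↦ ∑ l, h.weylFrame y e i j k l ^ 2)
      (fun _ _ ↦ Finset.sum_nonneg fun _ _ ↦ sq_nonneg _) (Finset.mem_univ k))
    exact Finset.single_le_sum (f := fun l ↦ h.weylFrame y e i j k l ^ 2) (fun _ _ ↦ sq_nonneg _)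
      (Finset.mem_univ l)
  exact pow_eq_zero_iff (n := 2) two_ne_zero |>.mp (le_antisymm (h0 ▸ hle) (sq_nonneg _))

/-- **`|E|²(y) = 0` makes the metric Einstein at `y`: `Ric = (R/4) h`** (the traceless Ricci
components vanish on an orthonormal basis, `tracelessRicciNormSq_eq_tracelessRicciNormSqFrame_four`,
and two bilinear forms agreeing on a basis agree). [cite: Besse1987, 1.118] -/
theorem ricci_eq_of_tracelessRicciNormSq_eq_zero (hh : h.IsRiemannian) {y : N}
    (hE : h.tracelessRicciNormSq y = 0) (X Y : TangentSpace (𝓡 4) y) :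
    h.ricci y X Y = h.scalarCurvature y / 4 * h.val y X Y := by
  classical
  obtain ⟨b, hb⟩ := h.exists_basis_isOrthonormalFrame (x := y) (fun v hv ↦ hh y v hv)
    finrank_euclideanFour
  have h0 : h.tracelessRicciNormSqFrame y ⇑b = 0 := by
    rw [← h.tracelessRicciNormSq_eq_tracelessRicciNormSqFrame_four finrank_euclideanFour hb]; exact hE
  have hab : ∀ a c, h.tracelessRicciFrame y ⇑b a c = 0 := by
    intro a c
    have hle : h.tracelessRicciFrame y ⇑b a c ^ 2 ≤ h.tracelessRicciNormSqFrame y ⇑b := by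
      unfold tracelessRicciNormSqFrame
      refine le_trans ?_ (Finset.single_le_sum (f := fun a ↦ ∑ c, h.tracelessRicciFrame y ⇑b a c ^ 2)
        (fun _ _ ↦ Finset.sum_nonneg fun _ _ ↦ sq_nonneg _) (Finset.mem_univ a))
      exact Finset.single_le_sum (f := fun c ↦ h.tracelessRicciFrame y ⇑b a c ^ 2)
        (fun _ _ ↦ sq_nonneg _) (Finset.mem_univ c)
    exact pow_eq_zero_iff (n := 2) two_ne_zero |>.mp (le_antisymm (h0 ▸ hle) (sq_nonneg _))
  -- on the basis
  have hbasis : ∀ a c, h.ricci y (b a) (b c) = h.scalarCurvature y / 4 * h.val y (b a) (b c) := by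
    intro a c
    have h1 := hab a c
    rw [tracelessRicciFrame_apply, Fintype.card_fin, sub_eq_zero] at h1
    rw [h1]
    by_cases hac : a = c
    · subst hac; simp [frameDelta, hb.1 a]
    · simp [frameDelta, hac, hb.2 a c hac]
  -- extend by bilinearity
  have heq : h.ricci y = (h.scalarCurvature y / 4) • h.toBilinForm y :=
    LinearMap.BilinForm.ext_basis b fun a c ↦ by
      rw [hbasis a c, LinearMap.smul_apply, LinearMap.smul_apply, toBilinForm_apply, smul_eq_mul]
  have := LinearMap.congr_fun₂ heq X Y
  rw [this, LinearMap.smul_apply, LinearMap.smul_apply, toBilinForm_apply, smul_eq_mul]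

/-- **`|Rm|² = |W|² + 2|E|² + R²/6` in dimension four** (Besse 1987, 1.116–1.118; through the tree's
`weylNormSq_eq_curvNormSqWith` and `tracelessRicciNormSq_eq_normSq`). [cite: Besse1987, (1.116)–1.118] -/
theorem curvNormSqWith_eq_weyl_add_traceless_add (hh : h.IsRiemannian) (y : N) :
    h.curvNormSqWith h.leviCivita y =
      h.weylNormSq y + 2 * h.tracelessRicciNormSq y + h.scalarCurvature y ^ 2 / 6 := by
  rw [h.weylNormSq_eq_curvNormSqWith hh finrank_euclideanFour,
    h.tracelessRicciNormSq_eq_normSq hh finrank_euclideanFour]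
  ring

end Pointwise

/-! ## STUB 4d -/

/-- **STUB 4d — SCALE-BREAKING PINCHING MAKES THE BLOW-UP LIMIT POINTWISE ROUND** (Hamilton 1986,
§5, p. 163; Huisken 1985, Thm. 1.1; Margerin 1998, Lemma 27). Along a Ricci flow with `m ≤ R` and
`|W|² + 2|E|² ≤ K R^{2−τ}` (`0 < τ ≤ 1`) at all points and times, for scales `Qₙ → ∞` and any data
`(N, h, p_∞, φₙ)` towards which the rescaled invariants `Qₙ⁻¹R`, `Qₙ⁻²|Rm|²`, `Qₙ⁻²|W|²`, `Qₙ⁻²|E|²`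
of `g(tₙ)` converge pointwise along `φₙ`, with `|Rm_h|²(p_∞) = 1`: all orthonormal-frame Weyl
components of `h` vanish, `Ric_h = (R_h/4) h`, and `R_h(p_∞) > 0`. Registered stub of the skeleton
`Cruxes/ChangGurskyYang/Lines/margerin_cone_hamilton_rails.lean` (reshape r5), statement verbatim.
[cite: Hamilton1986, §5, p. 163] [cite: Huisken1985, Thm. 1.1] [cite: Margerin1998, Part VI, Lemma 27 (p. 56)] -/
theorem stub_limitRound :
    ∀ (M : Type) [TopologicalSpace M] [T2Space M] [SecondCountableTopology M]
      [ChartedSpace (EuclideanSpace ℝ (Fin 4)) M] [IsManifold (𝓡 4) ∞ M]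
      (g : ℝ → PseudoRiemannianMetric (𝓡 4) ∞ (EuclideanSpace ℝ (Fin 4)) (TangentSpace (𝓡 4) : M → Type _))
      (cov : ℝ → CovariantDerivative (𝓡 4) (EuclideanSpace ℝ (Fin 4)) (TangentSpace (𝓡 4) : M → Type _))
      (T m K τ : ℝ), 0 < m → 0 < K → 0 < τ → τ ≤ 1 →
      IsRicciFlow g cov (Ico 0 T) → (∀ t ∈ Ico 0 T, (g t).IsRiemannian) →
      (∀ t ∈ Ico 0 T, ∀ [(g t).HasLeviCivita] (x : M),
        m ≤ (g t).scalarCurvature x ∧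
          (g t).weylNormSq x + 2 * (g t).tracelessRicciNormSq x ≤
            K * (g t).scalarCurvature x ^ (2 - τ)) →
      ∀ (t : ℕ → ℝ) (Q : ℕ → ℝ), (∀ n, t n ∈ Ico 0 T) → (∀ n, 0 < Q n) → Tendsto Q atTop atTop →
      ∀ (N : Type) [TopologicalSpace N] [ChartedSpace (EuclideanSpace ℝ (Fin 4)) N]
        [IsManifold (𝓡 4) ∞ N]
        (h : PseudoRiemannianMetric (𝓡 4) ∞ (EuclideanSpace ℝ (Fin 4)) (TangentSpace (𝓡 4) : N → Type _))
        [h.HasLeviCivita], h.IsRiemannian →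
      ∀ (pinf : N) (φ : ℕ → N → M) [∀ n, (g (t n)).HasLeviCivita],
        h.curvNormSqWith h.leviCivita pinf = 1 →
        (∀ y : N, Tendsto (fun n ↦ (Q n)⁻¹ * (g (t n)).scalarCurvatureWith (cov (t n)) (φ n y))
          atTop (𝓝 (h.scalarCurvature y))) →
        (∀ y : N, Tendsto (fun n ↦ (Q n)⁻¹ ^ 2 * (g (t n)).curvNormSqWith (cov (t n)) (φ n y))
          atTop (𝓝 (h.curvNormSqWith h.leviCivita y))) →
        (∀ y : N, Tendsto (fun n ↦ (Q n)⁻¹ ^ 2 * (g (t n)).weylNormSq (φ n y)) atTop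
          (𝓝 (h.weylNormSq y))) →
        (∀ y : N, Tendsto (fun n ↦ (Q n)⁻¹ ^ 2 * (g (t n)).tracelessRicciNormSq (φ n y)) atTop
          (𝓝 (h.tracelessRicciNormSq y))) →
        (∀ (y : N) (e : Fin 4 → TangentSpace (𝓡 4) y), h.IsOrthonormalFrame y e →
          ∀ i j k l, h.weylFrame y e i j k l = 0) ∧
        (∀ (y : N) (X Y : TangentSpace (𝓡 4) y),
          h.ricci y X Y = h.scalarCurvature y / 4 * h.val y X Y) ∧
        0 < h.scalarCurvature pinf := by
  intro M _ _ _ _ _ g cov T m K τ hm _hK hτ0 hτ1 hflow _hRiem hpinch t Q ht hQpos hQ N _ _ _ h _ hh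
    pinf φ _ hnorm hR _hRm hW hE
  have h2 : (2 : ℕ∞ω) ≤ ∞ := WithTop.coe_le_coe.mpr le_top
  -- along the flow, `scalarCurvatureWith (cov s)` is the scalar curvature of `g s`
  have hscal : ∀ s ∈ Ico 0 T, ∀ [(g s).HasLeviCivita] (x : M),
      (g s).scalarCurvatureWith (cov s) x = (g s).scalarCurvature x := by
    intro s hs _ x
    show (g s).trace x ((cov s).ricci x) = (g s).trace x ((g s).ricci x)
    rw [(hflow.isLeviCivita s hs).ricci_eq_ricci h2 x]
  -- Step 1: `|W_h|² = |E_h|² = 0` pointwise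
  have hzero : ∀ y : N, h.weylNormSq y = 0 ∧ h.tracelessRicciNormSq y = 0 := by
    intro y
    have hle : h.weylNormSq y + 2 * h.tracelessRicciNormSq y ≤ 0 := by
      refine le_zero_of_tendsto_rescaled (K := K) hτ0 (by linarith)
        ((hW y).add ((hE y).const_mul 2)) (hR y) hQ fun n ↦ ?_
      obtain ⟨hmR, hpin⟩ := hpinch (t n) (ht n) (φ n y)
      have hRpos : 0 < (g (t n)).scalarCurvature (φ n y) := hm.trans_le hmR
      have hs := hscal (t n) (ht n) (φ n y)
      rw [hs]
      calc (Q n)⁻¹ ^ 2 * (g (t n)).weylNormSq (φ n y) +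
            2 * ((Q n)⁻¹ ^ 2 * (g (t n)).tracelessRicciNormSq (φ n y))
          = (Q n)⁻¹ ^ 2 * ((g (t n)).weylNormSq (φ n y) +
              2 * (g (t n)).tracelessRicciNormSq (φ n y)) := by ring
        _ ≤ (Q n)⁻¹ ^ 2 * (K * (g (t n)).scalarCurvature (φ n y) ^ (2 - τ)) :=
            mul_le_mul_of_nonneg_left hpin (by positivity)
        _ = K * Q n ^ (-τ) * ((Q n)⁻¹ * (g (t n)).scalarCurvature (φ n y)) ^ (2 - τ) := by
            rw [mul_left_comm, rescale_rpow_eq τ (hQpos n) hRpos.le]; ring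
    have hWnn := h.weylNormSq_nonneg y
    have hEnn := h.tracelessRicciNormSq_nonneg y
    constructor <;> linarith
  refine ⟨fun y e he i j k l ↦ weylFrame_eq_zero_of_weylNormSq_eq_zero h (hzero y).1 he i j k l,
    fun y X Y ↦ ricci_eq_of_tracelessRicciNormSq_eq_zero h hh (hzero y).2 X Y, ?_⟩
  -- Step 4: `R_h(p_∞) = √6 > 0`
  have hRnn : 0 ≤ h.scalarCurvature pinf := by
    refine ge_of_tendsto' (hR pinf) fun n ↦ ?_
    have hs := hscal (t n) (ht n) (φ n pinf)
    rw [hs]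
    exact mul_nonneg (inv_nonneg.mpr (hQpos n).le) (hm.le.trans (hpinch (t n) (ht n) _).1)
  have hid := curvNormSqWith_eq_weyl_add_traceless_add h hh pinf
  rw [hnorm, (hzero pinf).1, (hzero pinf).2] at hid
  rcases hRnn.eq_or_lt with h0 | hpos
  · rw [← h0] at hid; norm_num at hid
  · exact hpos

end Summit.SmoothPoincare4.SmoothPoincare4.Theorems.MargerinRails

end
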